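import Mathlib
import Summits.NavierStokesRegularity.NavierStokesRegularity.Theorems.EulerZoomLiouvillePowerGaugeEulerLiouvilleHelicityTubeTubeTransportFree
import HarnessLib

/-!
# Crux `EulerZoomLiouville.PowerGaugeEulerLiouville` (stmt-NavierStokesRegularity-19832), width sub-line `chiral_anchor` (ns-idea-11 g10, REV3),
# stub K1 `stub_anchorFlow` — part (a): THE ANCHOR FLOW PACKAGE of a classical member on a velocity-bounded slab

Seat ns-ezl-w3 g8 (`--supports stmt-NavierStokesRegularity-19832 --as helper`; LEAD 19832 g16's key request 08:46:45Z).  In the lineage's cut-off idiom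
(`HelicityTube.tubesPersist_of_driftingPastWith_free`, `AnchoredBudget.*CutoffFlow`): for a classical Euler solution `u` on the open past, times
`t₁ < t₀ < 0` with the SLAB BOUND `‖u r x‖ ≤ B` on `[t₁,t₀] × ℝ³`, and a bump `φ` with plateau radius `R₀ + 3B(t₀−t₁) + 2`, the flow
`Ψ_r = ODE.evolutionMap (fun t x => φ x • u t x) t₀ r` of the CUT-OFF field anchored at `t₀` is, on the labels of `ball 0 R₀` and the times `r ∈ [t₁,t₀]`,
the particle flow of `u`:

* `ChiralAnchor.norm_flow_sub_le` — confinement `‖Ψ_r x − x‖ ≤ B(t₀−t₁)` (`SwirlfreeLedger.norm_evolutionMap_sub_le` with `κ = 0`), for EVERY `x`;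
* `ChiralAnchor.flow_mem_plateau` — GOOD labels `‖a‖ < R₀ + B(t₀−t₁) + 1` stay in the plateau ball on `[t₁,t₀]`;
* `ChiralAnchor.eventually_hasDerivAt_flow` — near a good label the trajectories solve `ẋ = u(r,x)` (`AnchoredBudget.hasDerivAt_cutoffFlow_of_mem`);
* ★ `ChiralAnchor.isAnchorFlow` — **the `IsAnchorFlow u t₁ t₀ T X` body of `Lines/chiral_anchor.lean` (δ-unfolded) for every `T ⊆ ball 0 R₀`** with the
  time-clamped flow `X r := Ψ_{max t₁ (min r t₀)}`: global joint continuity (`isSmoothSpaceTimeOn_evolutionMap` + clamping), `X t₀ = id`, trajectories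
  `HasDerivWithinAt … (Icc t₁ t₀)`, injectivity (`bijective_evolutionMap`), measurable images of the same volume and the `ℝ≥0∞` change of variables
  (`lintegral_image_eq_lintegral_abs_det_fderiv_mul` with Jacobian one, `AnchoredBudget.det_fderiv_cutoffFlow_eq_one`), all images in `ball 0 (R₀ + B(t₀−t₁) + 1)`.

Part (b) (`…ChiralAnchorTransport.lean`) adds the transported cut-offs and Moffatt's helicity and fills `Sig.stub_anchorFlow`.
HONEST FRAMING: kinematic bookkeeping for a width sub-line of the MODEL-lattice crux class (no kill: K4 `stub_anchorRace` is the heart and stays open);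
nothing about the crux E (19832 OPEN) or NS regularity is proved; not E. [cite: MajdaBertozziCUP2002, §1.3 Prop. 1.4, §1.6 Prop. 1.8; Hartman2002, Ch. V Cor. 3.1]
-/

noncomputable section

set_option linter.dupNamespace false

open MeasureTheory Set Filter Topology Metric Function InnerProductSpace
open scoped RealInnerProductSpace NNReal ENNReal ContDiff Topology

namespace Summit.NavierStokesRegularity.NavierStokesRegularity.Theorems.PowerGaugeEulerLiouville.ChiralAnchor

open Literature.Analysis Literature.Analysis.FluidPDE Literature.Analysis.ODE
open Summit.NavierStokesRegularity.NavierStokesRegularity.Theorems.PowerGaugeEulerLiouville.SwirlfreeLedger (norm_evolutionMap_sub_le)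
open Summit.NavierStokesRegularity.NavierStokesRegularity.Theorems.PowerGaugeEulerLiouville.AnchoredBudget
  (isSmoothSpaceTimeOn_cutoff isUniformlyLipschitzOn_cutoff hasDerivAt_cutoffFlow_of_mem det_fderiv_cutoffFlow_eq_one)

variable {u : ℝ → EuclideanSpace ℝ (Fin 3) → EuclideanSpace ℝ (Fin 3)} {p : ℝ → EuclideanSpace ℝ (Fin 3) → ℝ}
  {t₁ t₀ B R₀ : ℝ} {φ : ContDiffBump (0 : EuclideanSpace ℝ (Fin 3))}

/-- The time window `(t₁ − 1, t₀/2)`: open, convex, inside the past, containing `[t₁, t₀]`. -/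
theorem window_facts (ht : t₁ < t₀) (ht₀ : t₀ < 0) :
    IsOpen (Ioo (t₁ - 1) (t₀ / 2)) ∧ Convex ℝ (Ioo (t₁ - 1) (t₀ / 2)) ∧ Ioo (t₁ - 1) (t₀ / 2) ⊆ Iio 0 ∧
      t₁ ∈ Ioo (t₁ - 1) (t₀ / 2) ∧ t₀ ∈ Ioo (t₁ - 1) (t₀ / 2) ∧ Icc t₁ t₀ ⊆ Ioo (t₁ - 1) (t₀ / 2) := by
  refine ⟨isOpen_Ioo, convex_Ioo _ _, fun r hr => ?_, ⟨by linarith, by linarith⟩, ⟨by linarith, by linarith⟩, fun r hr => ⟨?_, ?_⟩⟩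
  · rw [mem_Iio]; exact lt_trans hr.2 (by linarith)
  · linarith [hr.1]
  · linarith [hr.2]

/-- **Confinement** (`κ = 0`): with the slab bound `‖u r x‖ ≤ B` on `[t₁,t₀]`, the cut-off flow anchored at `t₀` moves every point by at most `B(t₀ − r) ≤ B(t₀−t₁)`
backward to time `r ∈ [t₁,t₀]`. [cite: MajdaBertozziCUP2002, §4.2 (4.48)] -/
theorem norm_flow_sub_le (hcl : IsClassicalEulerSolutionOn (Iio 0) 0 u p) (ht : t₁ < t₀) (ht₀ : t₀ < 0)
    (hB : ∀ r ∈ Icc t₁ t₀, ∀ x : EuclideanSpace ℝ (Fin 3), ‖u r x‖ ≤ B) (x : EuclideanSpace ℝ (Fin 3)) {r : ℝ} (hr : r ∈ Icc t₁ t₀) :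
    ‖ODE.evolutionMap (fun t x => (φ : EuclideanSpace ℝ (Fin 3) → ℝ) x • u t x) t₀ r x - x‖ ≤ B * (t₀ - t₁) := by
  obtain ⟨hSo, hSc, hS0, ht₁S, ht₀S, hIcc⟩ := window_facts ht ht₀
  have hclS : IsClassicalEulerSolutionOn (Ioo (t₁ - 1) (t₀ / 2)) 0 u p := hcl.mono hS0 hSo.uniqueDiffOn
  have hLip := isUniformlyLipschitzOn_cutoff hclS.smooth_velocity hSo.uniqueDiffOn φ
  have hB0 : 0 ≤ B := (norm_nonneg _).trans (hB t₀ (right_mem_Icc.2 ht.le) 0)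
  have hspeed : ∀ s ∈ Icc t₁ t₀, ∀ y : EuclideanSpace ℝ (Fin 3),
      ‖(φ : EuclideanSpace ℝ (Fin 3) → ℝ) y • u s y‖ ≤ B * (-s) ^ (-(0 : ℝ)) := by
    intro s hs y
    rw [neg_zero, Real.rpow_zero, mul_one, norm_smul, Real.norm_of_nonneg φ.nonneg]
    calc φ y * ‖u s y‖ ≤ 1 * ‖u s y‖ := mul_le_mul_of_nonneg_right φ.le_one (norm_nonneg _)
      _ = ‖u s y‖ := one_mul _
      _ ≤ B := hB s hs y
  have h := norm_evolutionMap_sub_le hLip hSc hSo ht₁S ht₀S ht₀ (zero_lt_one) hspeed x hr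
  rw [sub_zero, div_one, Real.rpow_one, Real.rpow_one] at h
  refine h.trans ?_
  have : (-r) - (-t₀) ≤ t₀ - t₁ := by linarith [hr.1]
  nlinarith

/-- **Good labels stay in the plateau**: if `φ.rIn = R₀ + 3B(t₀−t₁) + 2`, every label `‖a‖ < R₀ + B(t₀−t₁) + 1` has its cut-off trajectory in the open
plateau ball `ball 0 φ.rIn` for all `r ∈ [t₁, t₀]`. [folklore] -/
theorem flow_mem_plateau (hcl : IsClassicalEulerSolutionOn (Iio 0) 0 u p) (ht : t₁ < t₀) (ht₀ : t₀ < 0)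
    (hB : ∀ r ∈ Icc t₁ t₀, ∀ x : EuclideanSpace ℝ (Fin 3), ‖u r x‖ ≤ B) (hφ : φ.rIn = R₀ + 3 * (B * (t₀ - t₁)) + 2)
    {a : EuclideanSpace ℝ (Fin 3)} (ha : ‖a‖ < R₀ + B * (t₀ - t₁) + 1) {r : ℝ} (hr : r ∈ Icc t₁ t₀) :
    ODE.evolutionMap (fun t x => (φ : EuclideanSpace ℝ (Fin 3) → ℝ) x • u t x) t₀ r a ∈ ball (0 : EuclideanSpace ℝ (Fin 3)) φ.rIn := by
  have hB0 : 0 ≤ B := (norm_nonneg _).trans (hB t₀ (right_mem_Icc.2 ht.le) 0)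
  have hD0 : 0 ≤ B * (t₀ - t₁) := mul_nonneg hB0 (by linarith)
  have h1 := norm_flow_sub_le (φ := φ) hcl ht ht₀ hB a hr
  rw [mem_ball_zero_iff, hφ]
  calc ‖ODE.evolutionMap (fun t x => (φ : EuclideanSpace ℝ (Fin 3) → ℝ) x • u t x) t₀ r a‖
      ≤ ‖a‖ + ‖ODE.evolutionMap (fun t x => (φ : EuclideanSpace ℝ (Fin 3) → ℝ) x • u t x) t₀ r a - a‖ := norm_le_norm_add_norm_sub' _ _
    _ < R₀ + B * (t₀ - t₁) + 1 + B * (t₀ - t₁) := add_lt_add_of_lt_of_le ha h1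
    _ ≤ R₀ + 3 * (B * (t₀ - t₁)) + 2 := by linarith

/-- **Near a good label the cut-off flow is the particle flow**: `∂_r Ψ_r(a′) = u(r, Ψ_r a′)` at every `r ∈ [t₁,t₀]`, for all `a′` near `a`.
[cite: MajdaBertozziCUP2002, §1.3 Prop. 1.4] -/
theorem eventually_hasDerivAt_flow (hcl : IsClassicalEulerSolutionOn (Iio 0) 0 u p) (ht : t₁ < t₀) (ht₀ : t₀ < 0)
    (hB : ∀ r ∈ Icc t₁ t₀, ∀ x : EuclideanSpace ℝ (Fin 3), ‖u r x‖ ≤ B) (hφ : φ.rIn = R₀ + 3 * (B * (t₀ - t₁)) + 2)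
    {a : EuclideanSpace ℝ (Fin 3)} (ha : ‖a‖ < R₀ + B * (t₀ - t₁) + 1) {r : ℝ} (hr : r ∈ Icc t₁ t₀) :
    ∀ᶠ a' in 𝓝 a, HasDerivAt (fun r' => ODE.evolutionMap (fun t x => (φ : EuclideanSpace ℝ (Fin 3) → ℝ) x • u t x) t₀ r' a')
      (u r (ODE.evolutionMap (fun t x => (φ : EuclideanSpace ℝ (Fin 3) → ℝ) x • u t x) t₀ r a')) r := by
  obtain ⟨hSo, hSc, hS0, ht₁S, ht₀S, hIcc⟩ := window_facts ht ht₀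
  have hclS : IsClassicalEulerSolutionOn (Ioo (t₁ - 1) (t₀ / 2)) 0 u p := hcl.mono hS0 hSo.uniqueDiffOn
  have hopen : IsOpen {a' : EuclideanSpace ℝ (Fin 3) | ‖a'‖ < R₀ + B * (t₀ - t₁) + 1} := isOpen_lt continuous_norm continuous_const
  filter_upwards [hopen.mem_nhds ha] with a' ha'
  exact hasDerivAt_cutoffFlow_of_mem hclS.smooth_velocity hSc hSo.uniqueDiffOn φ ht₀S (hSo.mem_nhds (hIcc hr))
    (ball_subset_closedBall (flow_mem_plateau hcl ht ht₀ hB hφ ha' hr))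

/-- ★ **THE ANCHOR FLOW PACKAGE** (= the body of `IsAnchorFlow u t₁ t₀ T X` of `Lines/chiral_anchor.lean`, δ-unfolded, for the time-clamped cut-off flow
`X r := Ψ_{max t₁ (min r t₀)}`): for a classical Euler solution on the open past, `t₁ < t₀ < 0`, the slab bound `‖u‖ ≤ B` on `[t₁,t₀] × ℝ³`, a bump with
`φ.rIn = R₀ + 3B(t₀−t₁) + 2`, and ANY label set `T ⊆ ball 0 R₀`. [cite: MajdaBertozziCUP2002, §1.3 Prop. 1.4; Hartman2002, Ch. V Cor. 3.1 eq. (3.5)] -/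
theorem isAnchorFlow (hcl : IsClassicalEulerSolutionOn (Iio 0) 0 u p) (ht : t₁ < t₀) (ht₀ : t₀ < 0)
    (hB : ∀ r ∈ Icc t₁ t₀, ∀ x : EuclideanSpace ℝ (Fin 3), ‖u r x‖ ≤ B) (hφ : φ.rIn = R₀ + 3 * (B * (t₀ - t₁)) + 2)
    {T : Set (EuclideanSpace ℝ (Fin 3))} (hT : T ⊆ ball (0 : EuclideanSpace ℝ (Fin 3)) R₀) :
    Continuous (fun q : ℝ × EuclideanSpace ℝ (Fin 3) =>
        ODE.evolutionMap (fun t x => (φ : EuclideanSpace ℝ (Fin 3) → ℝ) x • u t x) t₀ (max t₁ (min q.1 t₀)) q.2) ∧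
      (∀ y ∈ T, ODE.evolutionMap (fun t x => (φ : EuclideanSpace ℝ (Fin 3) → ℝ) x • u t x) t₀ (max t₁ (min t₀ t₀)) y = y) ∧
      (∀ r ∈ Icc t₁ t₀, ∀ y ∈ T, HasDerivWithinAt
        (fun σ : ℝ => ODE.evolutionMap (fun t x => (φ : EuclideanSpace ℝ (Fin 3) → ℝ) x • u t x) t₀ (max t₁ (min σ t₀)) y)
        (u r (ODE.evolutionMap (fun t x => (φ : EuclideanSpace ℝ (Fin 3) → ℝ) x • u t x) t₀ (max t₁ (min r t₀)) y)) (Icc t₁ t₀) r) ∧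
      (∀ r ∈ Icc t₁ t₀, InjOn (fun y => ODE.evolutionMap (fun t x => (φ : EuclideanSpace ℝ (Fin 3) → ℝ) x • u t x) t₀ (max t₁ (min r t₀)) y) T) ∧
      (∀ r ∈ Icc t₁ t₀, ∀ S ⊆ T, MeasurableSet S →
        MeasurableSet ((fun y => ODE.evolutionMap (fun t x => (φ : EuclideanSpace ℝ (Fin 3) → ℝ) x • u t x) t₀ (max t₁ (min r t₀)) y) '' S) ∧
          volume ((fun y => ODE.evolutionMap (fun t x => (φ : EuclideanSpace ℝ (Fin 3) → ℝ) x • u t x) t₀ (max t₁ (min r t₀)) y) '' S) = volume S) ∧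
      (∀ r ∈ Icc t₁ t₀, ∀ S ⊆ T, MeasurableSet S → ∀ g : EuclideanSpace ℝ (Fin 3) → ℝ≥0∞, Measurable g →
        ∫⁻ x in (fun y => ODE.evolutionMap (fun t x => (φ : EuclideanSpace ℝ (Fin 3) → ℝ) x • u t x) t₀ (max t₁ (min r t₀)) y) '' S, g x =
          ∫⁻ y in S, g (ODE.evolutionMap (fun t x => (φ : EuclideanSpace ℝ (Fin 3) → ℝ) x • u t x) t₀ (max t₁ (min r t₀)) y)) ∧
      (∃ R' : ℝ, ∀ r ∈ Icc t₁ t₀,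
        (fun y => ODE.evolutionMap (fun t x => (φ : EuclideanSpace ℝ (Fin 3) → ℝ) x • u t x) t₀ (max t₁ (min r t₀)) y) '' T ⊆
          ball (0 : EuclideanSpace ℝ (Fin 3)) R') := by
  obtain ⟨hSo, hSc, hS0, ht₁S, ht₀S, hIcc⟩ := window_facts ht ht₀
  have hSU : UniqueDiffOn ℝ (Ioo (t₁ - 1) (t₀ / 2)) := hSo.uniqueDiffOn
  have hclS : IsClassicalEulerSolutionOn (Ioo (t₁ - 1) (t₀ / 2)) 0 u p := hcl.mono hS0 hSU
  have hsmw := isSmoothSpaceTimeOn_cutoff hclS.smooth_velocity φ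
  have hLip := isUniformlyLipschitzOn_cutoff hclS.smooth_velocity hSU φ
  set E : ℝ → EuclideanSpace ℝ (Fin 3) → EuclideanSpace ℝ (Fin 3) :=
    ODE.evolutionMap (fun t x => (φ : EuclideanSpace ℝ (Fin 3) → ℝ) x • u t x) t₀ with hEdef
  have hB0 : 0 ≤ B := (norm_nonneg _).trans (hB t₀ (right_mem_Icc.2 ht.le) 0)
  have hD0 : 0 ≤ B * (t₀ - t₁) := mul_nonneg hB0 (by linarith)
  -- clamping
  have hclamp_mem : ∀ r : ℝ, max t₁ (min r t₀) ∈ Icc t₁ t₀ := fun r =>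
    ⟨le_max_left _ _, max_le ht.le (min_le_right _ _)⟩
  have hclamp_id : ∀ r ∈ Icc t₁ t₀, max t₁ (min r t₀) = r := fun r hr => by
    rw [min_eq_left hr.2, max_eq_right hr.1]
  -- good labels of `T`
  have hgoodT : ∀ y ∈ T, ‖y‖ < R₀ + B * (t₀ - t₁) + 1 := fun y hy => by
    have := mem_ball_zero_iff.1 (hT hy); linarith
  -- smoothness of the flow
  have hEs : IsSmoothSpaceTimeOn (Ioo (t₁ - 1) (t₀ / 2)) E := isSmoothSpaceTimeOn_evolutionMap hLip hsmw hSc hSU ht₀S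
  have hEslice : ∀ r ∈ Icc t₁ t₀, ContDiff ℝ ∞ (E r) := fun r hr => contDiff_evolutionMap_slice hLip hsmw hSc hSU ht₀S (hIcc hr)
  refine ⟨?_, ?_, ?_, ?_, ?_, ?_, ?_⟩
  · -- global joint continuity by clamping into `[t₁, t₀] ⊆ S`
    have hc : ContinuousOn (uncurry E) (Ioo (t₁ - 1) (t₀ / 2) ×ˢ univ) := hEs.continuousOn
    have hcl' : Continuous fun q : ℝ × EuclideanSpace ℝ (Fin 3) => ((max t₁ (min q.1 t₀), q.2) : ℝ × EuclideanSpace ℝ (Fin 3)) :=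
      (continuous_const.max (continuous_fst.min continuous_const)).prodMk continuous_snd
    have hmaps : ∀ q : ℝ × EuclideanSpace ℝ (Fin 3), ((max t₁ (min q.1 t₀), q.2) : ℝ × EuclideanSpace ℝ (Fin 3)) ∈
        Ioo (t₁ - 1) (t₀ / 2) ×ˢ (univ : Set (EuclideanSpace ℝ (Fin 3))) := fun q => mk_mem_prod (hIcc (hclamp_mem q.1)) (mem_univ _)
    exact hc.comp_continuous hcl' hmaps
  · -- `X t₀ = id`
    intro y _
    rw [min_self, max_eq_right ht.le]
    exact ODE.evolutionMap_self _ t₀ y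
  · -- trajectories
    intro r hr y hy
    have hderiv : HasDerivAt (fun r' => E r' y) (u r (E r y)) r :=
      (eventually_hasDerivAt_flow hcl ht ht₀ hB hφ (hgoodT y hy) hr).self_of_nhds
    rw [hclamp_id r hr]
    refine (hderiv.hasDerivWithinAt.congr (fun σ hσ => ?_) ?_)
    · show E (max t₁ (min σ t₀)) y = E σ y
      rw [hclamp_id σ hσ]
    · show E (max t₁ (min r t₀)) y = E r y
      rw [hclamp_id r hr]
  · -- injectivity
    intro r hr
    rw [hclamp_id r hr]
    exact (hLip.bijective_evolutionMap hSc ht₀S (hIcc hr)).injective.injOn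
  · -- measurable images of the same volume (Jacobian one on the good labels)
    intro r hr S hS hSm
    rw [hclamp_id r hr]
    have hinj : InjOn (E r) S := (hLip.bijective_evolutionMap hSc ht₀S (hIcc hr)).injective.injOn
    have hdiff : ∀ x ∈ S, HasFDerivWithinAt (E r) (fderiv ℝ (E r) x) S x := fun x _ =>
      (((hEslice r hr).differentiable (by simp)) x).hasFDerivAt.hasFDerivWithinAt
    have hdet : ∀ x ∈ S, (fderiv ℝ (E r) x).det = 1 := fun x hx =>
      det_fderiv_cutoffFlow_eq_one hclS hSc hSU φ ht₀S (hIcc hr) fun σ hσ =>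
        flow_mem_plateau hcl ht ht₀ hB hφ (hgoodT x (hS hx)) (by
          rw [uIcc_of_ge hr.2] at hσ; exact ⟨hr.1.trans hσ.1, hσ.2⟩)
    refine ⟨?_, ?_⟩
    · -- image = preimage under the continuous inverse map
      have himg : E r '' S = (ODE.evolutionMap (fun t x => (φ : EuclideanSpace ℝ (Fin 3) → ℝ) x • u t x) r t₀) ⁻¹' S ∩
          range (E r) := by
        ext z
        constructor
        · rintro ⟨y, hy, rfl⟩
          refine ⟨?_, mem_range_self y⟩
          show ODE.evolutionMap _ r t₀ (E r y) ∈ S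
          rw [hEdef, hLip.evolutionMap_symm hSc ht₀S (hIcc hr)]
          exact hy
        · rintro ⟨hz, -⟩
          refine ⟨ODE.evolutionMap (fun t x => (φ : EuclideanSpace ℝ (Fin 3) → ℝ) x • u t x) r t₀ z, hz, ?_⟩
          rw [hEdef, hLip.evolutionMap_symm hSc (hIcc hr) ht₀S]
      have hrange : range (E r) = univ := (hLip.bijective_evolutionMap hSc ht₀S (hIcc hr)).surjective.range_eq
      rw [himg, hrange, inter_univ]
      exact hSm.preimage (contDiff_evolutionMap_slice hLip hsmw hSc hSU (hIcc hr) ht₀S).continuous.measurable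
    · have h := lintegral_image_eq_lintegral_abs_det_fderiv_mul volume hSm hdiff hinj (fun _ => 1)
      calc volume (E r '' S) = ∫⁻ x in E r '' S, (1 : ℝ≥0∞) := (setLIntegral_one _).symm
        _ = ∫⁻ x in S, ENNReal.ofReal |(fderiv ℝ (E r) x).det| * 1 := h
        _ = ∫⁻ x in S, (1 : ℝ≥0∞) :=
          setLIntegral_congr_fun hSm fun x hx => by rw [hdet x hx, abs_one, ENNReal.ofReal_one, one_mul]
        _ = volume S := setLIntegral_one _
  · -- the `ℝ≥0∞` change of variables
    intro r hr S hS hSm g hg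
    rw [hclamp_id r hr]
    have hinj : InjOn (E r) S := (hLip.bijective_evolutionMap hSc ht₀S (hIcc hr)).injective.injOn
    have hdiff : ∀ x ∈ S, HasFDerivWithinAt (E r) (fderiv ℝ (E r) x) S x := fun x _ =>
      (((hEslice r hr).differentiable (by simp)) x).hasFDerivAt.hasFDerivWithinAt
    have hdet : ∀ x ∈ S, (fderiv ℝ (E r) x).det = 1 := fun x hx =>
      det_fderiv_cutoffFlow_eq_one hclS hSc hSU φ ht₀S (hIcc hr) fun σ hσ =>
        flow_mem_plateau hcl ht ht₀ hB hφ (hgoodT x (hS hx)) (by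
          rw [uIcc_of_ge hr.2] at hσ; exact ⟨hr.1.trans hσ.1, hσ.2⟩)
    rw [lintegral_image_eq_lintegral_abs_det_fderiv_mul volume hSm hdiff hinj g]
    exact setLIntegral_congr_fun hSm fun x hx => by rw [hdet x hx, abs_one, ENNReal.ofReal_one, one_mul]
  · -- one ball
    refine ⟨R₀ + B * (t₀ - t₁) + 1, fun r hr => ?_⟩
    rintro _ ⟨y, hy, rfl⟩
    rw [mem_ball_zero_iff]
    have h1 := norm_flow_sub_le (φ := φ) hcl ht ht₀ hB y (hclamp_mem r)
    have h2 := mem_ball_zero_iff.1 (hT hy)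
    calc ‖E (max t₁ (min r t₀)) y‖ ≤ ‖y‖ + ‖E (max t₁ (min r t₀)) y - y‖ := norm_le_norm_add_norm_sub' _ _
      _ < R₀ + B * (t₀ - t₁) + 1 := by linarith

end Summit.NavierStokesRegularity.NavierStokesRegularity.Theorems.PowerGaugeEulerLiouville.ChiralAnchor

end
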